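import Mathlib
import Literature.NumberTheory.LFunctions.Zhang2022.TypedSection17
import HarnessLib

/-!
# Zhang (2022) §17, the inner step u021 + u023 ⇒ u024 of the `Φ₃⁻` evaluation, with the
# error-summation estimate it tacitly needs made an explicit hypothesis — kernel edge

Topic `Literature/NumberTheory/LFunctions/Zhang2022` (Landau–Siegel audit tree; verdict-neutral).
Y. Zhang, *Discrete mean estimates and the Landau–Siegel zero*, arXiv:2211.02515v1 (2022)
[Zhang2022LandauSiegel] — **an unrefereed manuscript under adjudication**; the hypotheses below are
typed CLAIM nodes of the manuscript (`Typed.Section17`), stated not asserted. §17 p. 98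
(tex L4825–4837; DAG `Z22:§17.u021`, `Z22:§17.u023`, `Z22:§17.u024` of the cell siegel-zhang):

> [u021] `Σ_n (b∗ν₁*)(n)ϱ*(n)/n = Σ_{l<D⁴}(ν(l)/l)Σ_{l=l₁l₂}Σ_{(m₁,𝔮)=1} b(l₁m₁)ν₁*(l₂)κ̄₂(m₁)/m₁
> + o(1)`. … [u023] Hence, by Lemma 15.1 (see (15.)), `Σ_{(m₁,𝔮)=1} b(l₁m₁)κ̄₂(m₁)/m₁ =
> 𝔢₁χ(l₁)τ₂(l₁) + O` [bare]. [u024] It follows that `Σ_n (b∗ν₁*)(n)ϱ*(n)/n =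
> 𝔢₁Σ_{l<D⁴}(ν(l)/l)Σ_{l=l₁l₂}χ(l₁)τ₂(l₁)ν₁*(l₂) + o(1)`.

The error term of u023 is NOT PRINTED (a bare "`+O`"); the cell types it as the `O(α₁τ₂(l₁))` of
the cited Lemma 15.1 (`Typed.Section17.Step17_u023`). Substituting u023 into u021 termwise, "It
follows that [u024]" requires the summed error
`α₁ · E_D`, `E_D = Σ_{l<D⁴} (|ν(l)|/l) Σ_{l=l₁l₂} τ₂(l₁)|ν₁*(l₂)|`, to be `o(1)` — an estimate the
manuscript does not state (cf. the cell's GAP rows G-L4t6-1 on u023 and G-L4t3-3 on the §15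
analogue (15.22) → (15.23)). This file proves the inference WITH THAT ESTIMATE AS AN EXPLICIT
HYPOTHESIS, so that the adjudication record names exactly what u024 needs beyond u021 and u023:

* `step17_u024_of` — `Step17_u021 c′ → Step17_u023 c′ → (α𝓛·E_D = o(1) under (A)) → Step17_u024 c′`;
* `step17_u025_of` — u025(i) ("similar to (17.5)", CLAIM) ⇒ `Step17_u025 c′`, its second half
  `𝔢₁Σ_{l<D⁴}ν(l)²/l = 𝔢₁𝔞 + o(1)` being Lemma 17.1, a THEOREM of the tree (`appBLemma171_holds`).

(With `|ν₁*| ≤ τ₄` and `ν ≥ 0`, `E_D ≤ Σ_{l<D⁴} ν(l)τ₆(l)/l`, of the rough size `L′(1,χ)⁶ + O(1)`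
under (A); `α₁ = α𝓛 = π𝓛⁻⁸`; so the hypothesis amounts to `L′(1,χ) = o(𝓛^{4/3})`-type
information, or a sharper error term in u023 — recorded, not adjudicated, here.)
WHAT THIS IS NOT: a proof of u021, u023 or of the error estimate; any claim about Theorems 1–2 of
the source or about Landau–Siegel zeros; nothing here bears on the cell's verdict on (8.24).

## References

* Y. Zhang, arXiv:2211.02515v1 (2022), §17 p. 98 (u021–u024), Lemma 15.1 p. 86.
  [cite: Zhang2022LandauSiegel, §17 p.98]
-/

noncomputable section

open Complex Real ComplexConjugate Finset
open Literature.NumberTheory.LFunctions.Zhang2022.Skeleton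
open Literature.NumberTheory.LFunctions.Zhang2022.Typed.Section17

namespace Literature.NumberTheory.LFunctions.Zhang2022.Phi3Eval

/-- A constant pulls out of the coprimality-restricted series of u021/u023:
`Σ'_{(m,𝔮)=1} b(l₁m)ν₁*(l₂)κ̄₂(m)/m = ν₁*(l₂)·Σ'_{(m,𝔮)=1} b(l₁m)κ̄₂(m)/m`.
[cite: Zhang2022LandauSiegel, §17 p.98] -/
theorem tsum_coprime_mul_const {c' : ℝ} {D : ℕ} [NeZero D] (χ : DirichletCharacter ℂ D)
    (l₁ l₂ : ℕ) :
    (∑' m₁ : ℕ, if Nat.Coprime m₁ (frakq D) then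
        bcoef D (l₁ * m₁) * nuOneStar c' χ l₂ * kappa2bar c' D m₁ / (m₁ : ℂ) else 0) =
      nuOneStar c' χ l₂ *
        ∑' m₁ : ℕ, if Nat.Coprime m₁ (frakq D) then
          bcoef D (l₁ * m₁) * kappa2bar c' D m₁ / (m₁ : ℂ) else 0 := by
  rw [← tsum_mul_left]
  refine tsum_congr fun m₁ => ?_
  split_ifs
  · ring
  · simp

/-- Members `(l₁,l₂)` of the divisor antidiagonal of `l` with `1 ≤ l < D⁴` have `1 ≤ l₁ < D⁴`.
[folklore] -/
private theorem fst_bounds_of_mem_divisorsAntidiagonal {D l : ℕ} (hl : l ∈ Finset.Ico 1 (D ^ 4))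
    {q : ℕ × ℕ} (hq : q ∈ l.divisorsAntidiagonal) : 1 ≤ q.1 ∧ q.1 < D ^ 4 := by
  rw [Finset.mem_Ico] at hl
  rw [Nat.mem_divisorsAntidiagonal] at hq
  obtain ⟨hmul, hl0⟩ := hq
  have h1 : q.1 ∣ l := ⟨q.2, hmul.symm⟩
  have hle : q.1 ≤ l := Nat.le_of_dvd (by omega) h1
  have hpos : 0 < q.1 := Nat.pos_of_ne_zero fun h => hl0 (by rw [← hmul, h, zero_mul])
  exact ⟨hpos, lt_of_le_of_lt hle hl.2⟩

/-- **§17.u024 from §17.u021 and §17.u023, given the summed-error estimate** (§17 p. 98, "It follows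
that"): substituting u023 (`= 𝔢₁χ(l₁)τ₂(l₁) + O(α₁τ₂(l₁))`, error as typed by the cell — unprinted
in the source) into the double sum of u021 gives u024 up to
`C·α𝓛·E_D`, `E_D = Σ_{1≤l<D⁴}(|ν(l)|/l)Σ_{l=l₁l₂}τ₂(l₁)|ν₁*(l₂)|`; the hypothesis `hE` is exactly
"`α𝓛·E_D = o(1)` under (A)", which the manuscript does not state. With it the step is bookkeeping,
kernel-checked here. [cite: Zhang2022LandauSiegel, §17 u024 p.98] -/
theorem step17_u024_of {c' : ℝ} (h21 : Step17_u021 c') (h23 : Step17_u023 c')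
    (hE : ∀ ε : ℝ, 0 < ε → ForAllLarge fun D _ χ => AssumptionA D χ →
      alpha D * ell D * ∑ l ∈ Finset.Ico 1 (D ^ 4), ‖nu χ l‖ / l *
        ∑ q ∈ l.divisorsAntidiagonal, (q.1.divisors.card : ℝ) * ‖nuOneStar c' χ q.2‖ ≤ ε) :
    Step17_u024 c' := by
  intro ε hε
  obtain ⟨C, hC⟩ := h23
  have hε2 : 0 < ε / 2 := by positivity
  have hδ : 0 < ε / 2 / (|C| + 1) := by positivity
  obtain ⟨D₀, h⟩ := ((h21 _ hε2).and hC).and (hE _ hδ)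
  refine ⟨D₀, fun D _ χ hD hq hp hA => ?_⟩
  obtain ⟨⟨e21, e23⟩, eE⟩ := h D χ hD hq hp
  replace e21 := e21 hA
  replace e23 := e23 hA
  replace eE := eE hA
  -- names
  set V : ℂ := ∑' n : ℕ, bConvNuOne c' χ n * varrho17 c' χ n / (n : ℂ) with hV
  set inner : ℕ → ℂ := fun l₁ => ∑' m₁ : ℕ,
    if Nat.Coprime m₁ (frakq D) then bcoef D (l₁ * m₁) * kappa2bar c' D m₁ / (m₁ : ℂ) else 0
    with hinner
  set U : ℂ := ∑ l ∈ Finset.Ico 1 (D ^ 4), nu χ l / (l : ℂ) *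
    ∑ q ∈ l.divisorsAntidiagonal, ∑' m₁ : ℕ,
      if Nat.Coprime m₁ (frakq D) then
        bcoef D (q.1 * m₁) * nuOneStar c' χ q.2 * kappa2bar c' D m₁ / (m₁ : ℂ) else 0 with hU
  set W : ℂ := ∑ l ∈ Finset.Ico 1 (D ^ 4), nu χ l / (l : ℂ) *
    ∑ q ∈ l.divisorsAntidiagonal, χ (q.1 : ZMod D) * (q.1.divisors.card : ℂ) * nuOneStar c' χ q.2
    with hW
  set E : ℝ := ∑ l ∈ Finset.Ico 1 (D ^ 4), ‖nu χ l‖ / l *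
    ∑ q ∈ l.divisorsAntidiagonal, (q.1.divisors.card : ℝ) * ‖nuOneStar c' χ q.2‖ with hEdef
  -- u021's main term with the constant `ν₁*(l₂)` pulled out of the series
  have hU' : U = ∑ l ∈ Finset.Ico 1 (D ^ 4), nu χ l / (l : ℂ) *
      ∑ q ∈ l.divisorsAntidiagonal, nuOneStar c' χ q.2 * inner q.1 := by
    rw [hU]
    refine Finset.sum_congr rfl fun l _ => ?_
    congr 1
    refine Finset.sum_congr rfl fun q _ => ?_
    rw [hinner]
    exact tsum_coprime_mul_const χ q.1 q.2
  -- the termwise substitution of u023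
  have hdiff : U - frake 1 * W = ∑ l ∈ Finset.Ico 1 (D ^ 4), nu χ l / (l : ℂ) *
      ∑ q ∈ l.divisorsAntidiagonal, nuOneStar c' χ q.2 *
        (inner q.1 - frake 1 * χ (q.1 : ZMod D) * (q.1.divisors.card : ℂ)) := by
    rw [hU', hW, Finset.mul_sum, ← Finset.sum_sub_distrib]
    refine Finset.sum_congr rfl fun l _ => ?_
    rw [← mul_assoc, mul_comm (frake 1) (nu χ l / (l : ℂ)), mul_assoc, ← mul_sub, Finset.mul_sum,
      ← Finset.sum_sub_distrib]
    congr 1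
    refine Finset.sum_congr rfl fun q _ => ?_
    ring
  have hbound : ‖U - frake 1 * W‖ ≤ C * alpha D * ell D * E := by
    rw [hdiff]
    refine (norm_sum_le _ _).trans ?_
    rw [hEdef, Finset.mul_sum]
    refine Finset.sum_le_sum fun l hl => ?_
    rw [norm_mul, norm_div, Complex.norm_natCast]
    have hl0 : (0 : ℝ) ≤ ‖nu χ l‖ / (l : ℝ) := by positivity
    rw [mul_comm (C * alpha D * ell D), mul_assoc]
    refine mul_le_mul_of_nonneg_left ?_ hl0
    refine (norm_sum_le _ _).trans ?_
    rw [Finset.sum_mul]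
    refine Finset.sum_le_sum fun q hq => ?_
    obtain ⟨hq1, hq4⟩ := fst_bounds_of_mem_divisorsAntidiagonal hl hq
    rw [norm_mul]
    have h23q := e23 q.1 hq1 hq4
    calc ‖nuOneStar c' χ q.2‖ * ‖inner q.1 - frake 1 * χ (q.1 : ZMod D) * (q.1.divisors.card : ℂ)‖
        ≤ ‖nuOneStar c' χ q.2‖ * (C * alpha D * ell D * q.1.divisors.card) :=
          mul_le_mul_of_nonneg_left h23q (norm_nonneg _)
      _ = (q.1.divisors.card : ℝ) * ‖nuOneStar c' χ q.2‖ * (C * alpha D * ell D) := by ring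
  -- sizes: `C·α𝓛·E ≤ |C|·(α𝓛·E) ≤ |C|·(ε/2/(|C|+1)) ≤ ε/2`
  have hℓ : 0 ≤ ell D := Real.log_natCast_nonneg D
  have hα : 0 ≤ alpha D := by
    rw [alpha, bigP, Real.log_exp]; exact div_nonneg Real.pi_pos.le (pow_nonneg hℓ 9)
  have hE0 : 0 ≤ E := Finset.sum_nonneg fun l _ => mul_nonneg (by positivity)
    (Finset.sum_nonneg fun q _ => by positivity)
  have hαℓE : 0 ≤ alpha D * ell D * E := mul_nonneg (mul_nonneg hα hℓ) hE0
  have hCE : C * alpha D * ell D * E ≤ ε / 2 := by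
    calc C * alpha D * ell D * E = C * (alpha D * ell D * E) := by ring
      _ ≤ |C| * (alpha D * ell D * E) := mul_le_mul_of_nonneg_right (le_abs_self C) hαℓE
      _ ≤ |C| * (ε / 2 / (|C| + 1)) := mul_le_mul_of_nonneg_left eE (abs_nonneg C)
      _ ≤ ε / 2 := by
          rw [mul_div_assoc', div_le_iff₀ (by positivity)]
          nlinarith [abs_nonneg C]
  -- conclusion
  have hsplit : V - frake 1 * W = (V - U) + (U - frake 1 * W) := by ring
  show ‖V - frake 1 * W‖ ≤ ε
  rw [hsplit]
  calc ‖(V - U) + (U - frake 1 * W)‖ ≤ ‖V - U‖ + ‖U - frake 1 * W‖ := norm_add_le _ _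
    _ ≤ ε / 2 + C * alpha D * ell D * E := add_le_add e21 hbound
    _ ≤ ε / 2 + ε / 2 := by linarith
    _ = ε := by ring

/-! ## u025: its Lemma-17.1 half is a theorem -/

/-- `M ≤ 𝓛` once `D ≥ ⌈e^M⌉₊ + 1`. [folklore] -/
private theorem le_ell_of_ceil_le {M : ℝ} {D : ℕ} (hD : ⌈Real.exp M⌉₊ + 1 ≤ D) : M ≤ ell D := by
  have h1 : Real.exp M ≤ D := by
    have : (⌈Real.exp M⌉₊ : ℝ) + 1 ≤ D := by exact_mod_cast hD
    linarith [Nat.le_ceil (Real.exp M)]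
  have hD0 : (0 : ℝ) < D := lt_of_lt_of_le (Real.exp_pos M) h1
  rw [ell, Real.le_log_iff_exp_le hD0]
  exact h1

/-- For real `χ`, the typed sum `Σ_{1≤l<D⁴} ν(l)²/l` (complex) is the real sum `Σ_{n<D⁴}|ν(n)|²/n`
of the banked Lemma 17.1 (`n = 0` term vanishes; `ν(n)² = |ν(n)|²`, `Lemma31.divisorSumChar_sq_eq`).
[cite: Zhang2022LandauSiegel, §17 Lemma 17.1] -/
theorem sum_Ico_nu_sq_eq_ofReal_range {D : ℕ} [NeZero D] (χ : DirichletCharacter ℂ D)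
    (hχ : χ ^ 2 = 1) :
    ∑ l ∈ Finset.Ico 1 (D ^ 4), nu χ l ^ 2 / (l : ℂ) =
      ((∑ n ∈ Finset.range (D ^ 4), ‖nu χ n‖ ^ 2 / n : ℝ) : ℂ) := by
  have hD : 0 < D ^ 4 := pow_pos (Nat.pos_of_ne_zero (NeZero.ne D)) 4
  have h0 : ∑ n ∈ Finset.range (D ^ 4), ‖nu χ n‖ ^ 2 / (n : ℝ) =
      ∑ n ∈ Finset.Ico 1 (D ^ 4), ‖nu χ n‖ ^ 2 / (n : ℝ) := by
    rw [Finset.range_eq_Ico, Finset.sum_eq_sum_Ico_succ_bot hD]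
    simp
  rw [h0]
  push_cast
  refine Finset.sum_congr rfl fun n _ => ?_
  rw [show nu χ n = divisorSumChar χ n from rfl, Lemma31.divisorSumChar_sq_eq χ hχ n]
  push_cast
  ring

/-- **§17.u025, second printed equality, is a THEOREM; the first stays the claim.** u025 reads
"the right side [of u024] is equal to `𝔢₁Σ_{l<D⁴}ν(l)²/l + o(1)` [(i), "in a way similar to the
proof of (17.5)" — CLAIM] `= 𝔢₁𝔞 + o(1)` [(ii), "by Lemma 17.1"]"; (ii) is `|𝔢₁|` times the tree
theorem `appBLemma171_holds` (rate `𝓛⁻²⁰¹¹`). Edge: (i) ⇒ `Step17_u025 c′`.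
[cite: Zhang2022LandauSiegel, §17 u025 p.98] -/
theorem step17_u025_of {c' : ℝ}
    (hW : ∀ ε : ℝ, 0 < ε → ForAllLarge fun D _ χ => AssumptionA D χ →
      ‖frake 1 * (∑ l ∈ Finset.Ico 1 (D ^ 4), nu χ l / (l : ℂ) *
          ∑ q ∈ l.divisorsAntidiagonal,
            χ (q.1 : ZMod D) * (q.1.divisors.card : ℂ) * nuOneStar c' χ q.2) -
        frake 1 * ∑ l ∈ Finset.Ico 1 (D ^ 4), nu χ l ^ 2 / (l : ℂ)‖ ≤ ε) :
    Step17_u025 c' := by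
  intro ε hε
  obtain ⟨C, D₀, hC⟩ := appBLemma171_holds
  obtain ⟨D₁, h1⟩ := hW ε hε
  refine ⟨max (max D₀ D₁) (⌈Real.exp (max 1 (‖frake 1‖ * |C| / ε))⌉₊ + 1),
    fun D _ χ hD hq hp hA => ?_⟩
  have hD0 : D₀ ≤ D := le_trans (le_trans (le_max_left _ _) (le_max_left _ _)) hD
  have hD1 : D₁ ≤ D := le_trans (le_trans (le_max_right _ _) (le_max_left _ _)) hD
  have hℓ := le_ell_of_ceil_le (le_trans (le_max_right _ _) hD)
  have hℓ1 : 1 ≤ ell D := le_trans (le_max_left _ _) hℓ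
  have hℓC : ‖frake 1‖ * |C| / ε ≤ ell D := le_trans (le_max_right _ _) hℓ
  refine ⟨h1 D χ hD1 hq hp hA, ?_⟩
  have key := hC D χ hD0 hq hp hA
  rw [← mul_sub, norm_mul, sum_Ico_nu_sq_eq_ofReal_range χ hq.sq_eq_one, ← Complex.ofReal_sub,
    Complex.norm_real, Real.norm_eq_abs]
  have hℓpow : ell D ≤ ell D ^ 2011 := by
    calc ell D = ell D ^ 1 := (pow_one _).symm
      _ ≤ ell D ^ 2011 := pow_le_pow_right₀ hℓ1 (by norm_num)
  have hℓ0 : 0 < ell D := by linarith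
  have hS : |∑ n ∈ Finset.range (D ^ 4), ‖nu χ n‖ ^ 2 / (n : ℝ) - frakA χ| ≤ |C| / ell D :=
    key.trans ((div_le_div_of_nonneg_right (le_abs_self C) (by positivity)).trans
      (div_le_div_of_nonneg_left (abs_nonneg C) hℓ0 hℓpow))
  calc ‖frake 1‖ * |∑ n ∈ Finset.range (D ^ 4), ‖nu χ n‖ ^ 2 / (n : ℝ) - frakA χ|
      ≤ ‖frake 1‖ * (|C| / ell D) := mul_le_mul_of_nonneg_left hS (norm_nonneg _)
    _ = ‖frake 1‖ * |C| / ε * ε / ell D := by field_simp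
    _ ≤ ell D * ε / ell D := by gcongr
    _ = ε := by field_simp

end Literature.NumberTheory.LFunctions.Zhang2022.Phi3Eval
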